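import Summits.QuantumFields.YangMills.Theorems.BalabanUVNodesN16Thm4OutputLandau138
import Summits.QuantumFields.BalabanUV.T4Continuum.Spine.NE3.PairClassAkB8
import Summits.QuantumFields.BalabanUV.T4Continuum.Spine.NE3.PairReg335B8
import Summits.QuantumFields.BalabanUV.T4Continuum.Spine.NE3.PairFrameCondition
import HarnessLib

/-!
# Route «BalabanUVNodes» (cluster K4 «SpineRates»), Track-A DAG node N16 = NE3 — [B8] THEOREM 4 IN THE ALL-TORUS GEOMETRY (`Ω_j = T_η`, p. 77,
# the typed interface `B8Thm4TorusAt.Thm4TorusAt`) AS THE N05-SIDE HYPOTHESIS OF N16: (T4ᵀ) `∀ k ≥ 1, Thm4TorusAt L k (N·Lᵏ) (Lᵏ)⁻¹ c₁ unitaryUnits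
# (Reg335Zd (Lᵏ)⁻¹ L (𝒬 k) C) (Restr129 L k (torusLam k)) (Concl k)` ∧ the Concl-dictionary (DICT₁₃₈) ∧ N07's (H3ˢᵘᵖ) ⟹ file 9's edge binder (OUT₁₃₈) ⟹ N16

Cell `pub-ymgap`, seat `pub-ymgap-dag-n16-a` (KNIT-BY-NAME, HUMAN RULING D-0062; chair R424 venue), generation 4, file 10.  `bears_on: R4∕N16 · edge N05 → N16`.
Filed `--supports stmt-QuantumFields-19182`.  TRIGGER (iii) of generation 3's HANDOFF («a typed torus-geometry [B8] Thm 4 with uniqueness (u-periodicity)»)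
FIRED with n16-b's F6 `Literature/…/B8Thm4TorusAt` (p421962; census [N16B-CENSUS + INTERFACE-GAP-1], pub-ymgap INBOX l.10819, OWNER WORD l.11002) —
consumed here BY NAME with n16-b's pair dictionaries `PairClassAkB8.inAk_pair` (`𝔄_k({T_η}, α)` for both minimisers), `PairReg335B8.reg335Zd_rescale_bavg`
((1.33)'s second clause = [Balaban1985BackgroundPropagators] (3.35) at `W`) and F6's modus ponens `concl_of_thm4TorusAt_pair` (n16-b's staged
`Spine/NE3/PairThm4TorusB8` packages these three steps with uniqueness; §1 inlines the existence half over the landed primitives — no duplicate declaration).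

WHY.  Files 3∕4 assembled N16's N05-side from the CUBE-family interface `B8Eq119TwistedAxial.Thm4At` ([Balaban1985RegularSpaces] Prop. 6, (1.131)),
whose (1.29) at `j = 0` forces a LOCAL gauge — OVER-STRONG for THE END, which reads Theorem 4 in the admitted all-torus case `Ω_j = T_η` (p. 77), `Λ_j = ∅`
(`j < k`), `Λ_k = T^{(k)}`, periodic data, a periodic gauge (INTERFACE-GAP-1); files 7∕9 therefore stated the edge as Theorem 4's OUTPUT (OUT)∕(OUT₁₃₈).
HERE `Thm4TorusAt` takes (T4)'s place: the N05-side binders of N16 become (T4ᵀ) (print's Theorem 4, torus case; `Reg ∕ Restr` CONCRETE = `Reg335Zd`,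
`Restr129 L k (torusLam k)`; `Concl` abstract, N05's to instantiate) and (DICT₁₃₈) (the reading of `Concl k α₀ α₁ W U′ u` as print's (1.36)∕(1.38)∕(1.62)
letters at the pair: a bond field `A`, self-adjoint and periodic, `U₁ = U′^{u⁻¹} = e^{iηA}` (`mgauge W u (cfgExp η A) = U′`), `|A| ≤ s`, `|∇^η_W A| ≤ g′`
(`covDerivFwd`), (1.38) in node N05's letter `IsLandau138 L k η univ (torusLam k) W A`, THE END's Hölder (`s₂`, `β`) and Laplacian (`s₃`) members).
§1 `thm4OutputLandau138_of_thm4TorusAt` (any `d ≥ 1`): (T4ᵀ) ∧ (DICT₁₃₈) ∧ (H3ˢᵘᵖ) ⟹ (OUT₁₃₈).  §2 `n16_of_thm4TorusAt` (`d = 4`): the record knit — file 9 §3 ∘ §1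
at the displayed `α⋆ = min {1∕(3C₀(4)), c₂′(4,L)∕2, 1∕1056, c₁∕177}` of file 3.  §3 `ne3Shape_of_thm4TorusAt` (`d = 4`): the DECL column — file 9 §4 ∘ §1.

HONEST FRAMING.  Bookkeeping over LANDED theorems by name; (T4ᵀ) = [Balaban1985RegularSpaces] Thm 4 (p. 88) for `Ω_j = T_η` at CURVED backgrounds — node
N05's theorem, NOT proved anywhere in the tree (hypothesis-free only at `U₀ = 1`: `B8Thm4FlatTorus`, `B8Thm4MultiLevelTorus`; on `ℤᵈ` the existence half
modulo Prop 5 ∕ [4] Thm 3.3: `B8Thm4AtLandau138`); (DICT₁₃₈) = the reading of Thm 4's abstract conclusion slot in print's letters — a binder N05's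
instantiation of `Concl` discharges, not a theorem here; (H3ˢᵘᵖ) = N07's [Balaban1985Variational] Thm 1 (8)+(10) TYPE; **N16 ∕ NE3 is NOT discharged**;
count-neutral; one finite four-torus at fixed ε — NOT ℝ⁴, NOT infinite volume, NOT OS, NOT a mass gap, NOT Clay.
-/

set_option autoImplicit false

open scoped BigOperators Matrix Matrix.Norms.L2Operator
open NormedSpace

namespace Summit.QuantumFields.YangMills.BalabanUVNodes.N16

open Literature.MathematicalPhysics.QuantumFieldTheory.Balaban1983to89
open B7Prop1Explicit B7Prop2Explicit
open T4AveragingDeficitWall (IsUnitaryCfg Ad fineAction blockSites)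
open T4AveragingDeficitWallBoundary (IsPeriodicCfg periodBox)
open T4EtaRateMin (NE3Shape)
open B8Lemma1NonAbelian (pert)
open B7Eq92Concrete (mgauge)
open B8Ineq132 (covDerivFwd InAk)
open B8Eq146AExpansion (iEta)
open B8Eq184Proof (cfgExp)
open B8Eq119TwistedAxial (Restr129)
open B8Eq166ConstraintPair (ptw)
open B8Eq133Hypotheses (Reg335Zd)
open B8Eq138LandauZd (IsLandau138)
open B8Thm4TorusAt (torusLam torusLam_self Thm4TorusAt concl_of_thm4TorusAt_pair)
open B12Ineq417Flat (shiftCfg)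
open Summit.QuantumFields.BalabanUV.T4Continuum
open MinimalActionSandwich (IsMinimiser)
open MinimalActionRate (Regular sfClass rescale_bavg_mem_sfClass minActReadings)
open MinimalActionRefine (RegularSup gradConst)
open BlockAverageCurrent (curConst curConst_nonneg)
open NE3EnergyShapes (IsPeriodicSite)
open NE3EnergyWeightedCovShape (NE3EnergyRateWCov)
open NE3RightInverseSupLetters (frameC)
open NE3.PairLandauB8 (covLapDir)
open NE3.LeafIndexSockets (LeafH3sup)
open NE3.SupplierB8SfClassPrep (pdev_le_of_smallField)
open NE3.RemainderTowerPrepB8 (shiftCfg_of_isPeriodicCfg)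
open NE3.PairFrameCondition (avgIter_eq_of_isMinimiser avgIter_rescale_bavg_eq_of_isMinimiser)
open NE3.PairClassAkB8 (inAk_pair)
open NE3.PairReg335B8 (reg335Zd_rescale_bavg)

noncomputable section

variable {d : ℕ} {n : Type*} [Fintype n] [DecidableEq n]

/-! ## §1 (T4ᵀ) ∧ (DICT₁₃₈) ∧ (H3ˢᵘᵖ) ⟹ (OUT₁₃₈), any dimension -/

/-- **THEOREM 4 (TORUS GEOMETRY) AT THE MINIMISER PAIRS YIELDS THE OUTPUT BINDER (OUT₁₃₈)** (`d ≥ 1`, `L ≥ 2`; letters in the module docstring).  For every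
level `k ≥ 1`, datum `V ∈ dom` and minimiser pair `(U_A, U_B)`: (T4ᵀ) `Thm4TorusAt L k (N·Lᵏ) (Lᵏ)⁻¹ c₁ unitaryUnits (Reg335Zd (Lᵏ)⁻¹ L (𝒬 k) C) (Restr129 L k
(torusLam k)) (Concl k)` applies at `(U₀, U) = (W, U_A)` from row NE3's leaf data ALONE (`inAk_pair`, `reg335Zd_rescale_bavg`, `concl_of_thm4TorusAt_pair`) and
gives a PERIODIC unitary `u` with (1.29) on `Λ_k = T^{(k)}` and `Concl k α (11d²α) W U′ u`; (DICT₁₃₈) reads `Concl` as the letters of (OUT₁₃₈).  No existence is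
proved: (T4ᵀ) and (DICT₁₃₈) are the hypotheses. [folklore] -/
theorem thm4OutputLandau138_of_thm4TorusAt [Nonempty n] (hd : 1 ≤ d) {L N : ℕ} (hL : 2 ≤ L) {ε b g b' c' α c₁ s g' s₂ s₃ β : ℝ}
    (hε : 0 ≤ ε) (hb' : 0 ≤ b') (hc' : 0 ≤ c') (hb'1 : b' ≤ 1) (hRb : 2 ^ 15 * ((d : ℝ) + 1) ^ 2 * ((d : ℝ) + 4) ^ 2 * (L : ℝ) ^ 2 * b' ≤ 1)
    (hb'α : b' + 226 * (8 * (d + 1) * (d + 4)) ^ 2 * b' ^ 2 < α) (hc'α : 4 * ((d : ℝ) - 1) * (c' + curConst d L * b' ^ 2) < α)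
    (hα : 0 < α) (hεα : ε < α) (hα3 : C0 d * α ≤ 1 / 3) (hα2 : 2 * α ≤ c2' d L) (hsmall : 11 * (d : ℝ) ^ 2 * α ≤ 1 / 6)
    (hc₁ : α + 11 * (d : ℝ) ^ 2 * α ≤ c₁)
    {Mc : ℝ} (hMc : 0 ≤ Mc) (hMcα : (Mc + 1) * (b' + 226 * (8 * (d + 1) * (d + 4)) ^ 2 * b' ^ 2) ≤ 1 / 2)
    {𝒬 : ℕ → Set (Set (Site d) × ℕ)}
    (h𝒬 : ∀ k, ∀ q ∈ 𝒬 k, q.2 ≤ k ∧ ∃ y : Site d, ∀ z ∈ q.1, (l1 (z - y) : ℝ) ≤ Mc * (L : ℝ) ^ q.2)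
    {C : ℝ} (hC : 2 * (Mc + 1) * (b' + 226 * (8 * (d + 1) * (d + 4)) ^ 2 * b' ^ 2) + 2 * Mc * (2 * (c' + curConst d L * b' ^ 2)) +
      4 * Mc * (1 + 2 * Mc) * (b' + 226 * (8 * (d + 1) * (d + 4)) ^ 2 * b' ^ 2) ^ 2 < C)
    {Concl : ℕ → ℝ → ℝ → (Site d → Fin d → (Matrix n n ℂ)ˣ) → (Site d → Fin d → (Matrix n n ℂ)ˣ) → (Site d → (Matrix n n ℂ)ˣ) → Prop}
    (hT4 : ∀ k, 1 ≤ k → Thm4TorusAt L k (((N * L ^ k : ℕ) : ℤ)) (((L : ℝ) ^ k)⁻¹) c₁ (unitaryUnits (Matrix n n ℂ))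
      (Reg335Zd (((L : ℝ) ^ k)⁻¹) L (𝒬 k) C) (Restr129 L k (torusLam k)) (Concl k))
    {dom : Set (Site d → Fin d → (Matrix n n ℂ)ˣ)}
    (hdict :
      ∀ k : ℕ, 1 ≤ k → ∀ V ∈ dom, ∀ UA UB : Site d → Fin d → (Matrix n n ℂ)ˣ,
        IsMinimiser d (sfClass d L N ε) L N k V UA → IsMinimiser d (sfClass d L N ε) L N (k + 1) V UB →
        ∀ u : Site d → (Matrix n n ℂ)ˣ, (∀ x, u x ∈ unitaryUnits (Matrix n n ℂ)) →
          Concl k (α) (11 * (d : ℝ) ^ 2 * α) (rescale L (bavg L UB)) (pert (gaugeAct (ptw L (rescale L (bavg L UB)) UA k) UA) (rescale L (bavg L UB))) u →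
          ∃ A : Site d → Fin d → Matrix n n ℂ,
            (∀ x μ, IsSelfAdjoint (A x μ)) ∧ (∀ (x : Site d) (κ μ : Fin d), A (x + (((N * L ^ k : ℕ) : ℤ)) • e κ) μ = A x μ) ∧
            mgauge (rescale L (bavg L UB)) u (cfgExp (((L : ℝ) ^ k)⁻¹) A)
              = pert (gaugeAct (ptw L (rescale L (bavg L UB)) UA k) UA) (rescale L (bavg L UB)) ∧
            (∀ x μ, ‖A x μ‖ ≤ s) ∧
            (∀ (μ : Fin d) (x : Site d) (κ : Fin d), ‖covDerivFwd (((L : ℝ) ^ k)⁻¹) (rescale L (bavg L UB)) μ (fun z => A z κ) x‖ ≤ g') ∧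
            IsLandau138 L k (((L : ℝ) ^ k)⁻¹) Set.univ (torusLam k) (rescale L (bavg L UB)) A ∧
            (∀ (κ μ : Fin d) (y : Site d),
              ‖Ad (rescale L (bavg L UB) (y + e κ) μ)
                  (Ad (rescale L (bavg L UB) (y + e κ + e μ) μ)
                      ((fun x μ => Ad (rescale L (bavg L UB) x μ)⁻¹ (iEta (((L : ℝ) ^ k)⁻¹) A x μ)) (y + (2 : ℕ) • e μ) κ)
                    - (fun x μ => Ad (rescale L (bavg L UB) x μ)⁻¹ (iEta (((L : ℝ) ^ k)⁻¹) A x μ)) (y + e μ) κ)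
                - (Ad (rescale L (bavg L UB) (y + e κ) μ) ((fun x μ => Ad (rescale L (bavg L UB) x μ)⁻¹ (iEta (((L : ℝ) ^ k)⁻¹) A x μ)) (y + e μ) κ)
                  - (fun x μ => Ad (rescale L (bavg L UB) x μ)⁻¹ (iEta (((L : ℝ) ^ k)⁻¹) A x μ)) y κ)‖
                ≤ s₂ * (((L : ℝ)⁻¹) ^ k) ^ ((2 : ℝ) + β)) ∧
            (∀ (x : Site d) (κ : Fin d),
              ‖covLapDir (rescale L (bavg L UB)) (fun x μ => Ad (rescale L (bavg L UB) x μ)⁻¹ (iEta (((L : ℝ) ^ k)⁻¹) A x μ)) x κ‖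
                ≤ s₃ * (((L : ℝ)⁻¹) ^ k) ^ 3))
    (h3 : LeafH3sup d L N ε b' c' dom) :
    ∀ k : ℕ, 1 ≤ k → ∀ V ∈ dom, ∀ UA UB : Site d → Fin d → (Matrix n n ℂ)ˣ,
      IsMinimiser d (sfClass d L N ε) L N k V UA → IsMinimiser d (sfClass d L N ε) L N (k + 1) V UB → Regular d L N b g (k + 1) UB →
      ∃ u : Site d → (Matrix n n ℂ)ˣ, (∀ x, u x ∈ unitaryUnits (Matrix n n ℂ)) ∧ IsPeriodicSite u (((N * L ^ k : ℕ) : ℤ)) ∧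
        (∃ Λ : ℕ → Set (Site d), Λ k = Set.univ ∧ Restr129 L k Λ (rescale L (bavg L UB)) u) ∧
        ∃ A : Site d → Fin d → Matrix n n ℂ,
          (∀ x μ, IsSelfAdjoint (A x μ)) ∧ (∀ (x : Site d) (κ μ : Fin d), A (x + (((N * L ^ k : ℕ) : ℤ)) • e κ) μ = A x μ) ∧
          mgauge (rescale L (bavg L UB)) u (cfgExp (((L : ℝ) ^ k)⁻¹) A)
            = pert (gaugeAct (ptw L (rescale L (bavg L UB)) UA k) UA) (rescale L (bavg L UB)) ∧
          (∀ x μ, ‖A x μ‖ ≤ s) ∧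
          (∀ (μ : Fin d) (x : Site d) (κ : Fin d), ‖covDerivFwd (((L : ℝ) ^ k)⁻¹) (rescale L (bavg L UB)) μ (fun z => A z κ) x‖ ≤ g') ∧
          IsLandau138 L k (((L : ℝ) ^ k)⁻¹) Set.univ (torusLam k) (rescale L (bavg L UB)) A ∧
          (∀ (κ μ : Fin d) (y : Site d),
            ‖Ad (rescale L (bavg L UB) (y + e κ) μ)
                (Ad (rescale L (bavg L UB) (y + e κ + e μ) μ)
                    ((fun x μ => Ad (rescale L (bavg L UB) x μ)⁻¹ (iEta (((L : ℝ) ^ k)⁻¹) A x μ)) (y + (2 : ℕ) • e μ) κ)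
                  - (fun x μ => Ad (rescale L (bavg L UB) x μ)⁻¹ (iEta (((L : ℝ) ^ k)⁻¹) A x μ)) (y + e μ) κ)
              - (Ad (rescale L (bavg L UB) (y + e κ) μ) ((fun x μ => Ad (rescale L (bavg L UB) x μ)⁻¹ (iEta (((L : ℝ) ^ k)⁻¹) A x μ)) (y + e μ) κ)
                - (fun x μ => Ad (rescale L (bavg L UB) x μ)⁻¹ (iEta (((L : ℝ) ^ k)⁻¹) A x μ)) y κ)‖
              ≤ s₂ * (((L : ℝ)⁻¹) ^ k) ^ ((2 : ℝ) + β)) ∧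
          (∀ (x : Site d) (κ : Fin d),
            ‖covLapDir (rescale L (bavg L UB)) (fun x μ => Ad (rescale L (bavg L UB) x μ)⁻¹ (iEta (((L : ℝ) ^ k)⁻¹) A x μ)) x κ‖
              ≤ s₃ * (((L : ℝ)⁻¹) ^ k) ^ 3) := by
  intro k hk V hV UA UB hA hB _
  have hL1 : 1 ≤ L := le_trans (by norm_num) hL
  have hL2 : (2 : ℝ) ≤ L := by exact_mod_cast hL
  -- both minimisers are `RegularSup b′ c′` by (H3ˢᵘᵖ) (levels `k ≥ 1`, `k + 1`)
  obtain ⟨k', rfl⟩ : ∃ k', k = k' + 1 := ⟨k - 1, by omega⟩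
  have hregA : RegularSup d L N b' c' (k' + 1) UA := h3 V hV k' UA hA
  have hregB : RegularSup d L N b' c' (k' + 1 + 1) UB := h3 V hV (k' + 1) UB hB
  have hb4 : b' / ((L : ℝ) ^ (k' + 1)) ^ 2 ≤ 1 / 4 := by
    have hLk2 : (2 : ℝ) ≤ (L : ℝ) ^ (k' + 1) := by
      calc (2 : ℝ) = 2 ^ 1 := by norm_num
        _ ≤ (L : ℝ) ^ 1 := by gcongr
        _ ≤ (L : ℝ) ^ (k' + 1) := pow_le_pow_right₀ (by linarith) (by omega)
    have h4 : (4 : ℝ) ≤ ((L : ℝ) ^ (k' + 1)) ^ 2 := by nlinarith only [hLk2]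
    rw [div_le_div_iff₀ (by positivity) (by norm_num)]
    nlinarith only [h4, hb'1, hb']
  -- the pair's data: `W = rescale L (bavg L U_B)` and `U_A` unitary, periodic, small
  obtain ⟨hAu, hAP, hAsm⟩ := hA.mem.1
  have hbs' : 512 * (d + 1) * (d + 4) * (L : ℝ) ^ 2 * b' ≤ 1 := by
    have hd0 : (0 : ℝ) ≤ d := Nat.cast_nonneg d
    have hL2b : 0 ≤ (L : ℝ) ^ 2 * b' := by positivity
    have hX : (4 : ℝ) ≤ ((d : ℝ) + 1) * ((d : ℝ) + 4) := by nlinarith only [hd0]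
    have h1 : (512 : ℝ) * (d + 1) * (d + 4) ≤ 2 ^ 15 * ((d : ℝ) + 1) ^ 2 * ((d : ℝ) + 4) ^ 2 := by nlinarith only [hX, hd0]
    calc 512 * (d + 1) * (d + 4) * (L : ℝ) ^ 2 * b' = (512 * (d + 1) * (d + 4)) * ((L : ℝ) ^ 2 * b') := by ring
      _ ≤ (2 ^ 15 * ((d : ℝ) + 1) ^ 2 * ((d : ℝ) + 4) ^ 2) * ((L : ℝ) ^ 2 * b') := mul_le_mul_of_nonneg_right h1 hL2b
      _ = 2 ^ 15 * ((d : ℝ) + 1) ^ 2 * ((d : ℝ) + 4) ^ 2 * (L : ℝ) ^ 2 * b' := by ring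
      _ ≤ 1 := hRb
  obtain ⟨hWu, hWP, hWsm⟩ := rescale_bavg_mem_sfClass hL1 hb' hbs' le_rfl hregB.regular
  have hαW0 : 0 ≤ b' + 226 * (8 * (d + 1) * (d + 4)) ^ 2 * b' ^ 2 := by positivity
  have h34 : pdev UA < α * (((L : ℝ) ^ (k' + 1))⁻¹) ^ 2 := by
    refine (pdev_le_of_smallField (div_nonneg hε (by positivity)) hAsm).trans_lt ?_
    rw [inv_pow, ← div_eq_mul_inv]; exact div_lt_div_of_pos_right hεα (by positivity)
  have h33 : pdev (rescale L (bavg L UB)) < α * (((L : ℝ) ^ (k' + 1))⁻¹) ^ 2 := by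
    refine (pdev_le_of_smallField (div_nonneg hαW0 (by positivity)) hWsm).trans_lt ?_
    rw [inv_pow, ← div_eq_mul_inv]; exact div_lt_div_of_pos_right hb'α (by positivity)
  have hpair : avgIter L UA (k' + 1) = avgIter L (rescale L (bavg L UB)) (k' + 1) := by
    rw [avgIter_eq_of_isMinimiser hA, avgIter_rescale_bavg_eq_of_isMinimiser hB]
  have hAshift : ∀ i : Fin d, shiftCfg (((N * L ^ (k' + 1) : ℕ) : ℤ) • e i) UA = UA := fun i => shiftCfg_of_isPeriodicCfg hAP (e i)
  have hWshift : ∀ i : Fin d, shiftCfg (((N * L ^ (k' + 1) : ℕ) : ℤ) • e i) (rescale L (bavg L UB)) = rescale L (bavg L UB) :=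
    fun i => shiftCfg_of_isPeriodicCfg hWP (e i)
  -- (1.33) first clause ∕ (1.34): both data in `𝔄_k({T_η}, α)` (n16-b's g0 `PairClassAkB8`)
  obtain ⟨hAkW, hAkA, -⟩ := inAk_pair hd hL1 hA hB hregA hregB hb' hc' hb4 hRb hα.le hb'α hc'α (fun _ => Set.univ)
    (u₀ := fun _ => (1 : (Matrix n n ℂ)ˣ)) (fun _ => (unitaryUnits (Matrix n n ℂ)).one_mem)
  -- (1.33) second clause: [Balaban1985BackgroundPropagators] (3.35) at `W` (n16-b's g2 `PairReg335B8`)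
  have hReg : Reg335Zd (((L : ℝ) ^ (k' + 1))⁻¹) L (𝒬 (k' + 1)) C (rescale L (bavg L UB)) :=
    reg335Zd_rescale_bavg hL1 hregB hb' hc' hRb hMc hMcα (h𝒬 (k' + 1)) hC
  -- Theorem 4 (torus geometry) applies at the pair (n16-b's F6): the unique periodic `u` with (1.29) on `Λ_k = T^{(k)}` and `Concl`
  obtain ⟨u, ⟨hu, huP, hres, hconcl⟩, -⟩ := by
    letI : CStarAlgebra (Matrix n n ℂ) := {}
    have hG := avgClosed_unitaryUnits d (𝔸 := Matrix n n ℂ) L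
    exact concl_of_thm4TorusAt_pair L hL hd hG N (k' + 1) (hT4 (k' + 1) hk) (rescale L (bavg L UB)) UA hWu hAu hWshift hAshift hα hα3
      hα2 h33 h34 hpair hsmall hc₁ hAkW hReg hAkA
  -- the Concl-dictionary: print's (1.36)∕(1.38)∕(1.62) letters at the pair
  obtain ⟨A, hAsa, hAper, hmg, hs, hg, h138, hhol, hlap⟩ := hdict (k' + 1) hk V hV UA UB hA hB u hu hconcl
  exact ⟨u, hu, huP, ⟨torusLam (k' + 1), torusLam_self _, hres⟩, A, hAsa, hAper, hmg, hs, hg, h138, hhol, hlap⟩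

/-! ## §2 The `d = 4` record knit over (T4ᵀ) ∧ (DICT₁₃₈) ∧ (H3ˢᵘᵖ) -/

/-- **N16 · NE3 BY NAME FROM [B8] THM 4 IN THE ALL-TORUS GEOMETRY, ITS CONCL-DICTIONARY, AND N07's INTERFACE** (`d = 4`; `L ≥ 2`, `N ≥ 1`; Thm 4's constant
`c₁ > 0`; the DISPLAYED absolute letter `α⋆ = min {1∕(3C₀(4)), c₂′(4,L)∕2, 1∕1056, c₁∕177}`): `∃ r > 0` (function of `(L, N, n, c₁)`), `∀ g > 0, ∃ C ≥ 0` (function of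
`(L, N, n, g)`), `∀ b′ c′` on FOUR ε-free leaf lines, `∀ Mc ≥ 0` with `(Mc+1)(b′ + 226·320²·b′²) ≤ ½`, every radius-`Mc` cube-family system `𝒬`, every `C₃₃₅` above the
displayed threshold, `∀ 0 < ε ≤ r, 0 ≤ s₁ ≤ r, 0 ≤ b ≤ ε∕2`, `∀ g′` on `g′ + 2(b′ + 226·320²·b′²)·s₁ ≤ s₁`, `∀ s₂`, every level-indexed conclusion family `Concl`:
(T4ᵀ) `∀ k ≥ 1, Thm4TorusAt L k (N·Lᵏ) (Lᵏ)⁻¹ c₁ unitaryUnits (Reg335Zd (Lᵏ)⁻¹ L (𝒬 k) C₃₃₅) (Restr129 L k (torusLam k)) (Concl k)` → ∀ `dom`, (DICT₁₃₈) at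
`(α⋆, 11·4²·α⋆; s₁, g′, s₂, β = 1, s₁)` → `LeafH3sup 4 L N ε b′ c′ dom` → `NE3EnergyRateWCov 4 (sfClass 4 L N ε) L N b g C s₁ s₂ dom` (= `YMDAG.N16 L N ε b g C s₁ s₂ dom`).
File 9's `n16_of_thm4OutputLandau138` ∘ §1 (`r` shrunk by `α⋆∕2`).  The N05-side binders are (T4ᵀ) — [Balaban1985RegularSpaces] Thm 4, torus case, by its typed
name — and (DICT₁₃₈) only.  N16 ∕ NE3 NOT proved. [folklore] -/
theorem n16_of_thm4TorusAt [Nonempty n] {L N : ℕ} (hL : 2 ≤ L) (hN : 1 ≤ N) {c₁ : ℝ} (hc₁ : 0 < c₁) :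
    ∃ r : ℝ, 0 < r ∧ ∀ ⦃g : ℝ⦄, 0 < g → ∃ C : ℝ, 0 ≤ C ∧ ∀ ⦃b' c' : ℝ⦄, 0 ≤ b' → 0 ≤ c' →
      2 ^ 15 * ((4 : ℝ) + 1) ^ 2 * ((4 : ℝ) + 4) ^ 2 * (L : ℝ) ^ 2 * b' ≤ 1 →
      23040 * (4 : ℝ) ^ 4 * (frameC 4 L + 4) ^ 3 * (c' + curConst 4 L * b' ^ 2) ≤ 1 →
      b' + 226 * (8 * ((4 : ℝ) + 1) * ((4 : ℝ) + 4)) ^ 2 * b' ^ 2 < min (1 / (3 * C0 4)) (min (c2' 4 L / 2) (min (1 / 1056) (c₁ / 177))) →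
      4 * ((4 : ℝ) - 1) * (c' + curConst 4 L * b' ^ 2) < min (1 / (3 * C0 4)) (min (c2' 4 L / 2) (min (1 / 1056) (c₁ / 177))) →
      ∀ ⦃Mc : ℝ⦄, 0 ≤ Mc → (Mc + 1) * (b' + 226 * (8 * ((4 : ℝ) + 1) * ((4 : ℝ) + 4)) ^ 2 * b' ^ 2) ≤ 1 / 2 →
      ∀ (𝒬 : ℕ → Set (Set (Site 4) × ℕ)), (∀ k, ∀ q ∈ 𝒬 k, q.2 ≤ k ∧ ∃ y : Site 4, ∀ z ∈ q.1, (l1 (z - y) : ℝ) ≤ Mc * (L : ℝ) ^ q.2) →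
      ∀ ⦃C335 : ℝ⦄, 2 * (Mc + 1) * (b' + 226 * (8 * ((4 : ℝ) + 1) * ((4 : ℝ) + 4)) ^ 2 * b' ^ 2) + 2 * Mc * (2 * (c' + curConst 4 L * b' ^ 2)) +
        4 * Mc * (1 + 2 * Mc) * (b' + 226 * (8 * ((4 : ℝ) + 1) * ((4 : ℝ) + 4)) ^ 2 * b' ^ 2) ^ 2 < C335 →
      ∀ ⦃ε s₁ b : ℝ⦄, 0 < ε → ε ≤ r → 0 ≤ s₁ → s₁ ≤ r → 0 ≤ b → b ≤ ε / 2 →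
      ∀ ⦃g' : ℝ⦄, g' + 2 * (b' + 226 * (8 * ((4 : ℝ) + 1) * ((4 : ℝ) + 4)) ^ 2 * b' ^ 2) * s₁ ≤ s₁ → ∀ (s₂ : ℝ)
      (Concl : ℕ → ℝ → ℝ → (Site 4 → Fin 4 → (Matrix n n ℂ)ˣ) → (Site 4 → Fin 4 → (Matrix n n ℂ)ˣ) → (Site 4 → (Matrix n n ℂ)ˣ) → Prop),
      (∀ k, 1 ≤ k → Thm4TorusAt L k (((N * L ^ k : ℕ) : ℤ)) (((L : ℝ) ^ k)⁻¹) c₁ (unitaryUnits (Matrix n n ℂ))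
        (Reg335Zd (((L : ℝ) ^ k)⁻¹) L (𝒬 k) C335) (Restr129 L k (torusLam k)) (Concl k)) →
      ∀ {dom : _root_.Set (Site 4 → Fin 4 → (Matrix n n ℂ)ˣ)},
        (
        ∀ k : ℕ, 1 ≤ k → ∀ V ∈ dom, ∀ UA UB : Site 4 → Fin 4 → (Matrix n n ℂ)ˣ,
          IsMinimiser 4 (sfClass 4 L N ε) L N k V UA → IsMinimiser 4 (sfClass 4 L N ε) L N (k + 1) V UB →
          ∀ u : Site 4 → (Matrix n n ℂ)ˣ, (∀ x, u x ∈ unitaryUnits (Matrix n n ℂ)) →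
            Concl k (min (1 / (3 * C0 4)) (min (c2' 4 L / 2) (min (1 / 1056) (c₁ / 177)))) (11 * ((4 : ℕ) : ℝ) ^ 2 * min (1 / (3 * C0 4)) (min (c2' 4 L / 2) (min (1 / 1056) (c₁ / 177)))) (rescale L (bavg L UB)) (pert (gaugeAct (ptw L (rescale L (bavg L UB)) UA k) UA) (rescale L (bavg L UB))) u →
            ∃ A : Site 4 → Fin 4 → Matrix n n ℂ,
              (∀ x μ, IsSelfAdjoint (A x μ)) ∧ (∀ (x : Site 4) (κ μ : Fin 4), A (x + (((N * L ^ k : ℕ) : ℤ)) • e κ) μ = A x μ) ∧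
              mgauge (rescale L (bavg L UB)) u (cfgExp (((L : ℝ) ^ k)⁻¹) A)
                = pert (gaugeAct (ptw L (rescale L (bavg L UB)) UA k) UA) (rescale L (bavg L UB)) ∧
              (∀ x μ, ‖A x μ‖ ≤ s₁) ∧
              (∀ (μ : Fin 4) (x : Site 4) (κ : Fin 4), ‖covDerivFwd (((L : ℝ) ^ k)⁻¹) (rescale L (bavg L UB)) μ (fun z => A z κ) x‖ ≤ g') ∧
              IsLandau138 L k (((L : ℝ) ^ k)⁻¹) Set.univ (torusLam k) (rescale L (bavg L UB)) A ∧
              (∀ (κ μ : Fin 4) (y : Site 4),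
                ‖Ad (rescale L (bavg L UB) (y + e κ) μ)
                    (Ad (rescale L (bavg L UB) (y + e κ + e μ) μ)
                        ((fun x μ => Ad (rescale L (bavg L UB) x μ)⁻¹ (iEta (((L : ℝ) ^ k)⁻¹) A x μ)) (y + (2 : ℕ) • e μ) κ)
                      - (fun x μ => Ad (rescale L (bavg L UB) x μ)⁻¹ (iEta (((L : ℝ) ^ k)⁻¹) A x μ)) (y + e μ) κ)
                  - (Ad (rescale L (bavg L UB) (y + e κ) μ) ((fun x μ => Ad (rescale L (bavg L UB) x μ)⁻¹ (iEta (((L : ℝ) ^ k)⁻¹) A x μ)) (y + e μ) κ)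
                    - (fun x μ => Ad (rescale L (bavg L UB) x μ)⁻¹ (iEta (((L : ℝ) ^ k)⁻¹) A x μ)) y κ)‖
                  ≤ s₂ * (((L : ℝ)⁻¹) ^ k) ^ ((2 : ℝ) + 1)) ∧
              (∀ (x : Site 4) (κ : Fin 4),
                ‖covLapDir (rescale L (bavg L UB)) (fun x μ => Ad (rescale L (bavg L UB) x μ)⁻¹ (iEta (((L : ℝ) ^ k)⁻¹) A x μ)) x κ‖
                  ≤ s₁ * (((L : ℝ)⁻¹) ^ k) ^ 3)) →
        LeafH3sup 4 L N ε b' c' dom →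
        NE3EnergyRateWCov 4 (sfClass 4 L N ε) L N b g C s₁ s₂ dom := by
  have hL1 : 1 ≤ L := by omega
  obtain ⟨r, hr0, hr⟩ := n16_of_thm4OutputLandau138 (n := n) hL hN
  set α : ℝ := min (1 / (3 * C0 4)) (min (c2' 4 L / 2) (min (1 / 1056) (c₁ / 177))) with hαdef
  have hC0 : 0 < C0 4 := C0_pos 4
  have hc2 : 0 < c2' 4 L := c2'_pos 4 L hL1
  have hα0 : 0 < α := lt_min (by positivity) (lt_min (by positivity) (lt_min (by norm_num) (by positivity)))
  have hα1 : α ≤ 1 / (3 * C0 4) := min_le_left _ _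
  have hα2' : α ≤ c2' 4 L / 2 := (min_le_right _ _).trans (min_le_left _ _)
  have hα3' : α ≤ 1 / 1056 := (min_le_right _ _).trans ((min_le_right _ _).trans (min_le_left _ _))
  have hα4' : α ≤ c₁ / 177 := (min_le_right _ _).trans ((min_le_right _ _).trans (min_le_right _ _))
  have hα12 : α ≤ min (1 / (3 * C0 4)) (c2' 4 L / 2) := le_min hα1 hα2'
  refine ⟨min r (α / 2), lt_min hr0 (by positivity), fun g hg => ?_⟩
  obtain ⟨C, hC0', hC⟩ := hr hg
  refine ⟨C, hC0', fun b' c' hb' hc' hRb hcF hb'α hc'α Mc hMc hMcα 𝒬 h𝒬 C335 hC335 ε s₁ b hε hεr hs₁ hs₁r hb hbh g' hgrad s₂ Concl hT4 dom hdict h3 => ?_⟩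
  have hεr' : ε ≤ r := hεr.trans (min_le_left _ _)
  have hs₁r' : s₁ ≤ r := hs₁r.trans (min_le_left _ _)
  have hεα : ε < α := by linarith [hεr.trans (min_le_right r (α / 2))]
  have hA3 : C0 4 * α ≤ 1 / 3 := by
    rw [le_div_iff₀ (by positivity)] at hα1; linarith
  have hA2 : 2 * α ≤ c2' 4 L := by linarith
  have hAs : 11 * (((4 : ℕ) : ℝ)) ^ 2 * α ≤ 1 / 6 := by norm_num; linarith
  have hAc : α + 11 * (((4 : ℕ) : ℝ)) ^ 2 * α ≤ c₁ := by norm_num; linarith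
  -- the sup letters' lines
  have hb'1 : b' ≤ 1 := by
    have hL1r : (1 : ℝ) ≤ L := by exact_mod_cast hL1
    have hL2 : (1 : ℝ) ≤ (L : ℝ) ^ 2 := one_le_pow₀ hL1r
    nlinarith
  have hRb' : 2 ^ 15 * ((((4 : ℕ) : ℝ)) + 1) ^ 2 * ((((4 : ℕ) : ℝ)) + 4) ^ 2 * (L : ℝ) ^ 2 * b' ≤ 1 := by simpa only [Nat.cast_ofNat] using hRb
  have hb'α' : b' + 226 * (8 * ((4 : ℕ) + 1 : ℝ) * ((4 : ℕ) + 4 : ℝ)) ^ 2 * b' ^ 2 < α := by simpa using hb'α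
  have hb'α₁ : b' + 226 * (8 * ((4 : ℝ) + 1) * ((4 : ℝ) + 4)) ^ 2 * b' ^ 2 < min (1 / (3 * C0 4)) (c2' 4 L / 2) := lt_of_lt_of_le hb'α hα12
  have hc'α' : 4 * ((((4 : ℕ) : ℝ)) - 1) * (c' + curConst 4 L * b' ^ 2) < α := by simpa only [Nat.cast_ofNat] using hc'α
  have hMcα' : (Mc + 1) * (b' + 226 * (8 * ((4 : ℕ) + 1 : ℝ) * ((4 : ℕ) + 4 : ℝ)) ^ 2 * b' ^ 2) ≤ 1 / 2 := by simpa using hMcα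
  have hC335' : 2 * (Mc + 1) * (b' + 226 * (8 * ((4 : ℕ) + 1 : ℝ) * ((4 : ℕ) + 4 : ℝ)) ^ 2 * b' ^ 2) + 2 * Mc * (2 * (c' + curConst 4 L * b' ^ 2)) +
      4 * Mc * (1 + 2 * Mc) * (b' + 226 * (8 * ((4 : ℕ) + 1 : ℝ) * ((4 : ℕ) + 4 : ℝ)) ^ 2 * b' ^ 2) ^ 2 < C335 := by simpa using hC335
  exact hC hb' hc' hRb hcF hb'α₁ hε hεr' hs₁ hs₁r' hb hbh hgrad s₂
    (thm4OutputLandau138_of_thm4TorusAt (by norm_num) hL hε.le hb' hc' hb'1 hRb' hb'α' hc'α' hα0 hεα hA3 hA2 hAs hAc hMc hMcα' h𝒬 hC335' hT4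
      hdict h3) h3

/-! ## §3 The DECL column over (T4ᵀ) ∧ (DICT₁₃₈) ∧ (H3ˢᵘᵖ) -/

/-- **N16 · THE ROW's DECL `T4EtaRateMin.NE3Shape` FROM [B8] THM 4 IN THE ALL-TORUS GEOMETRY** (`d = 4`; `L ≥ 2`, `N ≥ 1`; Thm 4's constant `c₁ > 0`, `α⋆` as in
§2) — file 9's `ne3Shape_of_thm4OutputLandau138` (g2's numeric regime verbatim, `r` shrunk by `α⋆∕2`; N05's regularity letter `g := gradConst 4 c`) with (OUT₁₃₈)
REPLACED by (T4ᵀ) ∧ (DICT₁₃₈) (at `(α⋆, 11·4²·α⋆; s₁, g′, s₂, β = 1, s₁)`) plus file 3 §3's two ε-free leaf lines on `(b, c)` against `α⋆` and the (3.35) schedule;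
(H3ˢᵘᵖ) `LeafH3sup 4 L N ε b c dom`.  CONCLUSION verbatim: a regular selection of minimisers exists and for every such selection `∃ C′ ≥ 0, NE3Shape (minActReadings
4 (sfClass 4 L N ε) L N dom loc_D) C′ (L⁻¹)`.  File 9 §4 ∘ §1.  N16 ∕ NE3 NOT proved. [folklore] -/
theorem ne3Shape_of_thm4TorusAt [Nonempty n] {L N : ℕ} (hL : 2 ≤ L) (hN : 1 ≤ N) {c₁ : ℝ} (hc₁ : 0 < c₁) :
    ∃ r : ℝ, 0 < r ∧ ∀ ⦃ε s₁ t b c ε₁ : ℝ⦄, 0 < ε → ε ≤ r → 0 ≤ s₁ → s₁ ≤ r →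
      0 ≤ b → b ≤ t → 0 < c → c ≤ t →
      (2 : ℝ) ^ 91 * (L : ℝ) ^ 17 * t ≤ 1 → (2 : ℝ) ^ 76 * (L : ℝ) ^ 12 * t ≤ ε →
      16 * C0 4 * ε ≤ 3 → 1024 * (4 + 1) * (4 + 4) * (L : ℝ) ^ 2 * ε ≤ 1 → b ≤ ε / 2 →
      23040 * (4 : ℝ) ^ 4 * (frameC 4 L + 4) ^ 3 * (c + curConst 4 L * b ^ 2) ≤ 1 →
      b + 226 * (8 * ((4 : ℝ) + 1) * ((4 : ℝ) + 4)) ^ 2 * b ^ 2 < min (1 / (3 * C0 4)) (min (c2' 4 L / 2) (min (1 / 1056) (c₁ / 177))) →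
      4 * ((4 : ℝ) - 1) * (c + curConst 4 L * b ^ 2) < min (1 / (3 * C0 4)) (min (c2' 4 L / 2) (min (1 / 1056) (c₁ / 177))) →
      ε₁ ≤ 1 / 4 → ε₁ ≤ b → 4 * ε₁ ≤ c →
      ∀ ⦃Mc : ℝ⦄, 0 ≤ Mc → (Mc + 1) * (b + 226 * (8 * ((4 : ℝ) + 1) * ((4 : ℝ) + 4)) ^ 2 * b ^ 2) ≤ 1 / 2 →
      ∀ (𝒬 : ℕ → Set (Set (Site 4) × ℕ)), (∀ k, ∀ q ∈ 𝒬 k, q.2 ≤ k ∧ ∃ y : Site 4, ∀ z ∈ q.1, (l1 (z - y) : ℝ) ≤ Mc * (L : ℝ) ^ q.2) →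
      ∀ ⦃C335 : ℝ⦄, 2 * (Mc + 1) * (b + 226 * (8 * ((4 : ℝ) + 1) * ((4 : ℝ) + 4)) ^ 2 * b ^ 2) + 2 * Mc * (2 * (c + curConst 4 L * b ^ 2)) +
        4 * Mc * (1 + 2 * Mc) * (b + 226 * (8 * ((4 : ℝ) + 1) * ((4 : ℝ) + 4)) ^ 2 * b ^ 2) ^ 2 < C335 →
      ∀ ⦃g' : ℝ⦄, g' + 2 * (b + 226 * (8 * ((4 : ℝ) + 1) * ((4 : ℝ) + 4)) ^ 2 * b ^ 2) * s₁ ≤ s₁ → ∀ (s₂ : ℝ)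
      (Concl : ℕ → ℝ → ℝ → (Site 4 → Fin 4 → (Matrix n n ℂ)ˣ) → (Site 4 → Fin 4 → (Matrix n n ℂ)ˣ) → (Site 4 → (Matrix n n ℂ)ˣ) → Prop),
      (∀ k, 1 ≤ k → Thm4TorusAt L k (((N * L ^ k : ℕ) : ℤ)) (((L : ℝ) ^ k)⁻¹) c₁ (unitaryUnits (Matrix n n ℂ))
        (Reg335Zd (((L : ℝ) ^ k)⁻¹) L (𝒬 k) C335) (Restr129 L k (torusLam k)) (Concl k)) →
      ∀ {dom : Set (Site 4 → Fin 4 → (Matrix n n ℂ)ˣ)}, dom ⊆ sfClass 4 L N ε₁ 0 →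
        (
        ∀ k : ℕ, 1 ≤ k → ∀ V ∈ dom, ∀ UA UB : Site 4 → Fin 4 → (Matrix n n ℂ)ˣ,
          IsMinimiser 4 (sfClass 4 L N ε) L N k V UA → IsMinimiser 4 (sfClass 4 L N ε) L N (k + 1) V UB →
          ∀ u : Site 4 → (Matrix n n ℂ)ˣ, (∀ x, u x ∈ unitaryUnits (Matrix n n ℂ)) →
            Concl k (min (1 / (3 * C0 4)) (min (c2' 4 L / 2) (min (1 / 1056) (c₁ / 177)))) (11 * ((4 : ℕ) : ℝ) ^ 2 * min (1 / (3 * C0 4)) (min (c2' 4 L / 2) (min (1 / 1056) (c₁ / 177)))) (rescale L (bavg L UB)) (pert (gaugeAct (ptw L (rescale L (bavg L UB)) UA k) UA) (rescale L (bavg L UB))) u →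
            ∃ A : Site 4 → Fin 4 → Matrix n n ℂ,
              (∀ x μ, IsSelfAdjoint (A x μ)) ∧ (∀ (x : Site 4) (κ μ : Fin 4), A (x + (((N * L ^ k : ℕ) : ℤ)) • e κ) μ = A x μ) ∧
              mgauge (rescale L (bavg L UB)) u (cfgExp (((L : ℝ) ^ k)⁻¹) A)
                = pert (gaugeAct (ptw L (rescale L (bavg L UB)) UA k) UA) (rescale L (bavg L UB)) ∧
              (∀ x μ, ‖A x μ‖ ≤ s₁) ∧
              (∀ (μ : Fin 4) (x : Site 4) (κ : Fin 4), ‖covDerivFwd (((L : ℝ) ^ k)⁻¹) (rescale L (bavg L UB)) μ (fun z => A z κ) x‖ ≤ g') ∧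
              IsLandau138 L k (((L : ℝ) ^ k)⁻¹) Set.univ (torusLam k) (rescale L (bavg L UB)) A ∧
              (∀ (κ μ : Fin 4) (y : Site 4),
                ‖Ad (rescale L (bavg L UB) (y + e κ) μ)
                    (Ad (rescale L (bavg L UB) (y + e κ + e μ) μ)
                        ((fun x μ => Ad (rescale L (bavg L UB) x μ)⁻¹ (iEta (((L : ℝ) ^ k)⁻¹) A x μ)) (y + (2 : ℕ) • e μ) κ)
                      - (fun x μ => Ad (rescale L (bavg L UB) x μ)⁻¹ (iEta (((L : ℝ) ^ k)⁻¹) A x μ)) (y + e μ) κ)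
                  - (Ad (rescale L (bavg L UB) (y + e κ) μ) ((fun x μ => Ad (rescale L (bavg L UB) x μ)⁻¹ (iEta (((L : ℝ) ^ k)⁻¹) A x μ)) (y + e μ) κ)
                    - (fun x μ => Ad (rescale L (bavg L UB) x μ)⁻¹ (iEta (((L : ℝ) ^ k)⁻¹) A x μ)) y κ)‖
                  ≤ s₂ * (((L : ℝ)⁻¹) ^ k) ^ ((2 : ℝ) + 1)) ∧
              (∀ (x : Site 4) (κ : Fin 4),
                ‖covLapDir (rescale L (bavg L UB)) (fun x μ => Ad (rescale L (bavg L UB) x μ)⁻¹ (iEta (((L : ℝ) ^ k)⁻¹) A x μ)) x κ‖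
                  ≤ s₁ * (((L : ℝ)⁻¹) ^ k) ^ 3)) →
        LeafH3sup 4 L N ε b c dom →
        (∃ sel : ℕ → (Site 4 → Fin 4 → (Matrix n n ℂ)ˣ) → (Site 4 → Fin 4 → (Matrix n n ℂ)ˣ),
            ∀ V ∈ dom, ∀ k : ℕ, IsMinimiser 4 (sfClass 4 L N ε) L N k V (sel k V) ∧ RegularSup 4 L N b c k (sel k V)) ∧
        ∀ sel : ℕ → (Site 4 → Fin 4 → (Matrix n n ℂ)ˣ) → (Site 4 → Fin 4 → (Matrix n n ℂ)ˣ),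
          (∀ V ∈ dom, ∀ k : ℕ, IsMinimiser 4 (sfClass 4 L N ε) L N k V (sel k V)) →
          (∀ V ∈ dom, ∀ k : ℕ, RegularSup 4 L N b c k (sel k V)) →
          ∃ C' : ℝ, 0 ≤ C' ∧
            NE3Shape
              (minActReadings 4 (sfClass 4 L N ε) L N dom
                (fun k V (x : ↥(periodBox (d := 4) N)) =>
                  fineAction (sel k V) (((blockSites L)^[k] {(x : Site 4)}) ×ˢ Finset.univ)))
              C' ((L : ℝ)⁻¹) := by
  have hL1 : 1 ≤ L := by omega
  obtain ⟨r, hr0, hr⟩ := ne3Shape_of_thm4OutputLandau138 (n := n) hL hN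
  set α : ℝ := min (1 / (3 * C0 4)) (min (c2' 4 L / 2) (min (1 / 1056) (c₁ / 177))) with hαdef
  have hC0 : 0 < C0 4 := C0_pos 4
  have hc2 : 0 < c2' 4 L := c2'_pos 4 L hL1
  have hα0 : 0 < α := lt_min (by positivity) (lt_min (by positivity) (lt_min (by norm_num) (by positivity)))
  have hα1 : α ≤ 1 / (3 * C0 4) := min_le_left _ _
  have hα2' : α ≤ c2' 4 L / 2 := (min_le_right _ _).trans (min_le_left _ _)
  have hα3' : α ≤ 1 / 1056 := (min_le_right _ _).trans ((min_le_right _ _).trans (min_le_left _ _))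
  have hα4' : α ≤ c₁ / 177 := (min_le_right _ _).trans ((min_le_right _ _).trans (min_le_right _ _))
  have hα12 : α ≤ min (1 / (3 * C0 4)) (c2' 4 L / 2) := le_min hα1 hα2'
  refine ⟨min r (α / 2), lt_min hr0 (by positivity),
    fun ε s₁ t b c ε₁ hε hεr hs₁ hs₁r hb hbt hc hct hsmall hεt hε1 hε2 hbε hcF hbα' hcα' hε₁ hε₁b hε₁c Mc hMc hMcα 𝒬 h𝒬 C335 hC335 g' hgrad s₂ Concl
      hT4 dom hdom hdict h3 => ?_⟩
  have hεr' : ε ≤ r := hεr.trans (min_le_left _ _)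
  have hs₁r' : s₁ ≤ r := hs₁r.trans (min_le_left _ _)
  have hεα : ε < α := by linarith [hεr.trans (min_le_right r (α / 2))]
  have hA3 : C0 4 * α ≤ 1 / 3 := by
    rw [le_div_iff₀ (by positivity)] at hα1; linarith
  have hA2 : 2 * α ≤ c2' 4 L := by linarith
  have hAs : 11 * (((4 : ℕ) : ℝ)) ^ 2 * α ≤ 1 / 6 := by norm_num; linarith
  have hAc : α + 11 * (((4 : ℕ) : ℝ)) ^ 2 * α ≤ c₁ := by norm_num; linarith
  -- the sup letters' lines ((Rb) from the numeral, as in g2's knit)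
  have hL1r : (1 : ℝ) ≤ L := by exact_mod_cast hL1
  have hRb0 : 2 ^ 15 * ((4 : ℝ) + 1) ^ 2 * ((4 : ℝ) + 4) ^ 2 * (L : ℝ) ^ 2 * b ≤ 1 := by
    have h2 : (L : ℝ) ^ 2 ≤ (L : ℝ) ^ 17 := pow_le_pow_right₀ hL1r (by norm_num)
    have e : 2 ^ 15 * ((4 : ℝ) + 1) ^ 2 * ((4 : ℝ) + 4) ^ 2 * (L : ℝ) ^ 2 * b = 52428800 * ((L : ℝ) ^ 2 * b) := by ring
    rw [e]
    have h5 : (L : ℝ) ^ 2 * b ≤ (L : ℝ) ^ 17 * t := mul_le_mul h2 hbt hb (by positivity)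
    have h6 : (2 : ℝ) ^ 91 * ((L : ℝ) ^ 17 * t) ≤ 1 := by linarith [hsmall]
    have h7 : 0 ≤ (L : ℝ) ^ 17 * t := le_trans (by positivity) h5
    linarith [h5, h6, h7]
  have hb1 : b ≤ 1 := by
    have hL2 : (1 : ℝ) ≤ (L : ℝ) ^ 2 := one_le_pow₀ hL1r
    nlinarith
  have hRb : 2 ^ 15 * ((((4 : ℕ) : ℝ)) + 1) ^ 2 * ((((4 : ℕ) : ℝ)) + 4) ^ 2 * (L : ℝ) ^ 2 * b ≤ 1 := by
    simpa only [Nat.cast_ofNat] using hRb0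
  have hcα'' : 4 * ((((4 : ℕ) : ℝ)) - 1) * (c + curConst 4 L * b ^ 2) < α := by simpa only [Nat.cast_ofNat] using hcα'
  have hbα'' : b + 226 * (8 * ((4 : ℕ) + 1 : ℝ) * ((4 : ℕ) + 4 : ℝ)) ^ 2 * b ^ 2 < α := by simpa using hbα'
  have hbα₁ : b + 226 * (8 * ((4 : ℝ) + 1) * ((4 : ℝ) + 4)) ^ 2 * b ^ 2 < min (1 / (3 * C0 4)) (c2' 4 L / 2) := lt_of_lt_of_le hbα' hα12
  have hMcα' : (Mc + 1) * (b + 226 * (8 * ((4 : ℕ) + 1 : ℝ) * ((4 : ℕ) + 4 : ℝ)) ^ 2 * b ^ 2) ≤ 1 / 2 := by simpa using hMcα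
  have hC335' : 2 * (Mc + 1) * (b + 226 * (8 * ((4 : ℕ) + 1 : ℝ) * ((4 : ℕ) + 4 : ℝ)) ^ 2 * b ^ 2) + 2 * Mc * (2 * (c + curConst 4 L * b ^ 2)) +
      4 * Mc * (1 + 2 * Mc) * (b + 226 * (8 * ((4 : ℕ) + 1 : ℝ) * ((4 : ℕ) + 4 : ℝ)) ^ 2 * b ^ 2) ^ 2 < C335 := by simpa using hC335
  exact hr hε hεr' hs₁ hs₁r' hb hbt hc hct hsmall hεt hε1 hε2 hbε hcF hbα₁ hε₁ hε₁b hε₁c hgrad s₂ hdom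
    (thm4OutputLandau138_of_thm4TorusAt (by norm_num) hL hε.le hb hc.le hb1 hRb hbα'' hcα'' hα0 hεα hA3 hA2 hAs hAc hMc hMcα' h𝒬 hC335' hT4
      hdict h3) h3

end

end Summit.QuantumFields.YangMills.BalabanUVNodes.N16
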